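import Literature.Barriers.CriticalPhenomena.FKParafermionicHalfCauchyRiemann
import Literature.Probability.LatticeModels.DartPhase
import Literature.Probability.LatticeModels.HoleFreePotential
import Literature.Probability.Percolation.InterfaceScalingLimitDiscretised
import HarnessLib

/-!
# Vocabulary of the line `zhou-rotation-split-audit` for the crux `CardySelfRefinement.SymmetryUpgradeR`
# (stmt-CriticalPhenomena-17239)

Route-posited objects (D-0016: reviewed `Defs` module), VERBATIM the `§0 Vocabulary` block of the
checked skeleton `Cruxes/SymmetryUpgradeR/Lines/zhou_rotation_split_audit.lean` (revision 2, lead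
prover-line-stmt-CriticalPhenomena-17239-a1-0; `ledger skeleton check` OK, five registered stubs
`stub_halfCR`, `stub_rotationSplit`, `stub_halfPlaneOneArm`, `stub_zhouBackEnd`,
`stub_allDomainsOfZhouClass`), so that the stub helper files
`Theorems/CardySelfRefinementSymmetryUpgradeR<Stub>.lean` (this module: `Theorems/CardySelfRefinementSymmetryUpgradeRZhouDefs.lean`) (each proving `theorem <stubName> : <registered
signature>` by name, `--supports stmt-CriticalPhenomena-17239`) and the closing skeleton share ONE copy of
every object — same idiom as `CardyComplexConeDefs.lean` / `CardySusyWardParafermionFamiliesToSLESixDefs.lean`.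
Nothing in this file is asserted: every `def … : Prop` is a statement to be proved by a registered stub
(W. Zhou, *SLE₆ and 2-d critical bond percolation on the square lattice*, arXiv:2409.03235 v6, unrefereed —
the line AUDITS it; the typed statements are what his Props. 4.3 / eq. (10) / Thms 1–2 assert, not facts).

* `edgeObs E e` — Smirnov's `q = 1`, spin-`1/3` EDGE parafermionic observable of the medial
  exploration path, = the tree's `bondDartObservable E E.δ (1/3) e` (no re-declared notion);
* `bdist E p` — distance of the medial vertex `p` to the square-lattice discrete boundary;
* `HalfCR c` — the vertex relation (2)/(95) with coefficient `c` on finite admissible data with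
  hole-free inner faces (S1; `c = i` by the landed `S2.halfCRVertexRelation_of_holeFree`);
* `RotationSplit c θ K` — the typed rotation split, Zhou Prop. 4.3 (93)–(98) (S2, the bet);
* `halfBoxArm n`, `HalfPlaneOneArm` — Zhou's input (10), the half-plane one-arm law `n^{-1/3}` (S3);
* `IsRectilinear`, `IsCornerMark`, `SLESixOnZhouClass` — the convex-corner-marked rectilinear
  Dobrushin polygons and SLE₆ convergence along one admissible family on them (S4's conclusion,
  S5's hypothesis).
-/

noncomputable section

namespace Summit.CriticalPhenomena.CardyFormulaZ2.Theorems.SymmetryUpgradeR.ZhouRotationSplitAudit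

open MeasureTheory Filter Set Metric
open Literature.Probability.RandomPlanarGeometry Literature.Probability.LatticeModels
open Literature.Probability.Percolation (BondConfig bondPercolation half openConnIn)
open Literature.Barriers.CriticalPhenomena (medialCornersAt medialVertexOf HalfCRRelationAt halfCREquations)

/-- Smirnov's `q = 1` (spin `1/3`) EDGE parafermionic observable of the exploration path of the
discrete Dobrushin datum `E` under critical bond percolation on `ℤ²`, at the medial edge (corner)
`e = (v, f)`: `F_E(e) = E_{1/2}[exp(−(i/3) W(e)) 1_{e ∈ γ}]`, `W(e)` the winding of the polyline of
medial midpoints from the first medial edge up to and including `e` — the tree's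
`bondDartObservable E E.δ (1/3) e` (`DartPhase.lean`: expectation of `dartPhaseSum`, which is
verbatim the planner's `edgePassage`; equal to `cornerObs E E.δ v f` of `CardyComplexConeDefs.lean`,
`cornerObs_eq_bondDartObservable`).  Zhou's `e^{+iW(e,e_b)/3}` (winding measured to `e_b`) differs by
the unimodular constant `e^{iW_tot/3}` of the datum, immaterial for every linear relation below.
[cite: Smirnov2010, §2.2] [cite: DuminilCopin2012Parafermion, Definition 3] [cite: Zhou2024SLE6BondZ2, §1.2, eq. (1)–(2)] -/
def edgeObs (E : DiscreteDobrushin) (e : Site 2 × Site 2) : ℂ :=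
  bondDartObservable E E.δ (1 / 3) e

/-- Distance from the medial vertex indexed by `p = (x, i)` (midpoint of the lattice edge
`[x, x + eᵢ]` at mesh `E.δ`) to the square-lattice discrete boundary of the datum (Zhou's `d_v`,
up to `δ/2`). [cite: Zhou2024SLE6BondZ2, §2] -/
def bdist (E : DiscreteDobrushin) (p : Site 2 × Fin 2) : ℝ :=
  Metric.infDist (medialPoint E.δ (medialVertexOf p)) (meshPoint E.δ '' E.zdBoundary)

/-- **(2)/(95) for the raw observable, with coefficient `c`.**  On every finite admissible datum of
positive mesh WHOSE INNER FACES ARE HOLE-FREE (e.g. every admissible discretisation of a Dobrushin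
domain, `holeFree_innerFaces`) the edge observable satisfies the vertex relation
`F(NW) − F(SE) = c (F(NE) − F(SW))` at every interior medial vertex (`halfCREquations E`).  True for
exactly one `c ∈ {i, −i}` (the value records the orientation conventions of `winding` /
`medialCornersAt`; it is `c = i`, `S2.halfCRVertexRelation_of_holeFree`).  Without hole-freeness the
relation fails (admissible annular data: a loop of the loop representation winding around the hole
touches the interface from the wrong side and its phase `e^{∓2πi/3}` sees the orientation).
[cite: DuminilCopin2012Parafermion, Proposition 4] -/
def HalfCR (c : ℂ) : Prop :=
  ∀ E : DiscreteDobrushin, E.IsZdAdmissible → HoleFree {f : Site 2 | E.IsInnerFace f} → 0 < E.δ →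
    (meshDomain E.Ω E.δ).Finite → ∀ p ∈ halfCREquations E, HalfCRRelationAt c (edgeObs E) p

/-- **The rotation split with defect exponent `θ` and constant `K`** (typed necessary consequence
of Zhou's Prop. 4.3): every finite admissible datum with hole-free inner faces carries PER-VERTEX
edge values `Ft p : Fin 4 → ℂ` (his `F̃(e_v)`, `e_v ∈ {NW, NE, SE, SW}` clockwise as in
`medialCornersAt`) with (95) the vertex relation EXACT for `Ft p`;
(96) `|Ft(NW)+Ft(SE)−Ft(NE)−Ft(SW)| ≤ K (δ/d)^θ`; (98) `|Σ_e (F − Ft)(e)| ≤ K (δ/d)^θ` for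
`F_i := F − Ft`; (93) the two values given to one medial edge by its two end-vertices differ by
`≤ K (δ/d)^θ`.  ((97) for `F_i` follows from `HalfCR c`.)
[cite: Zhou2024SLE6BondZ2, Proposition 4.3, (93)–(98)] -/
def RotationSplit (c : ℂ) (θ K : ℝ) : Prop :=
  ∀ E : DiscreteDobrushin, E.IsZdAdmissible → HoleFree {f : Site 2 | E.IsInnerFace f} → 0 < E.δ →
    (meshDomain E.Ω E.δ).Finite →
    ∃ Ft : Site 2 × Fin 2 → Fin 4 → ℂ, ∀ p ∈ halfCREquations E,
      Ft p 0 - Ft p 2 = c * (Ft p 1 - Ft p 3) ∧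
      ‖Ft p 0 + Ft p 2 - Ft p 1 - Ft p 3‖ ≤ K * (E.δ / bdist E p) ^ θ ∧
      ‖(edgeObs E (medialCornersAt p.1 p.2 0) + edgeObs E (medialCornersAt p.1 p.2 1) +
            edgeObs E (medialCornersAt p.1 p.2 2) + edgeObs E (medialCornersAt p.1 p.2 3)) -
          (Ft p 0 + Ft p 1 + Ft p 2 + Ft p 3)‖ ≤ K * (E.δ / bdist E p) ^ θ ∧
      ∀ p' ∈ halfCREquations E, ∀ k k' : Fin 4,
        medialCornersAt p.1 p.2 k = medialCornersAt p'.1 p'.2 k' →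
          ‖Ft p k - Ft p' k'‖ ≤ K * (E.δ / bdist E p) ^ θ

/-- The half-plane one-arm event at scale `n`: the origin is joined by open edges, inside the
half-box `[−n, n] × [0, n]`, to its outer boundary (the event of `CardyBoundaryCoulombGas.HalfPlaneOneArmThird`,
stmt-CriticalPhenomena-5662). [cite: SmirnovWerner2001, Theorem 3] -/
def halfBoxArm (n : ℕ) : Set (BondConfig (Site 2)) :=
  {ω | ∃ y : Site 2, (y 0 = (n : ℤ) ∨ y 0 = -(n : ℤ) ∨ y 1 = (n : ℤ)) ∧
    ω ∈ openConnIn {v : Site 2 | 0 ≤ v 1 ∧ -(n : ℤ) ≤ v 0 ∧ v 0 ≤ n ∧ v 1 ≤ n} 0 y}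

/-- **Zhou's input (10)**: `c n^{-1/3} ≤ P(A⁺₁(0, n)) ≤ c⁻¹ n^{-1/3}` for bond percolation on `ℤ²`
at `p = 1/2` ([IkPon12] = Ikhlef–Ponsaing 2012; in tree only the named fact
`IkhlefPonsaingFirstPassage`, unproved).  A STATEMENT of the line (registered stub `stub_halfPlaneOneArm`),
not a fact: Zhou arXiv:2409.03235 v6, eq. (10); Ikhlef–Ponsaing, J. Stat. Phys. 149 (2012). -/
def HalfPlaneOneArm : Prop :=
  ∃ c : ℝ, 0 < c ∧ ∀ᶠ n : ℕ in atTop,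
    c * (n : ℝ) ^ (-((1 : ℝ) / 3)) ≤ (bondPercolation (zdGraph 2) half).real (halfBoxArm n) ∧
      (bondPercolation (zdGraph 2) half).real (halfBoxArm n) ≤ c⁻¹ * (n : ℝ) ^ (-((1 : ℝ) / 3))

/-- Rectilinear Dobrushin polygon: the Jordan boundary is a finite union of axis-parallel segments
(verbatim the sibling crux's `IsRectilinear`, line `free-arc-touch-covariance-martingale` of
stmt-10814; e.g. `polygonDomain` of an axis-parallel simple closed polygon). [folklore] -/
def IsRectilinear (D : DobrushinDomain) : Prop :=
  ∃ S : Finset (ℂ × ℂ), (∀ e ∈ S, (e.1 - e.2).re = 0 ∨ (e.1 - e.2).im = 0) ∧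
    frontier D.carrier = ⋃ e ∈ S, segment ℝ e.1 e.2

/-- The marked point `D.pt i` is an axis-parallel CONVEX RIGHT-ANGLE CORNER of `D`: near it `D` is
an open quadrant (in coordinates rotated by the axis direction `η`).  This is where Zhou's
Condition C ("the arguments of `(v*_{n*+1} − v*_{n*})/(v₁ − v₂)` and `(vₙ − vₙ₊₁)/(v*₂ − v*₁)`
are `π/2`": the wired arc and the dual-wired arc meet at right angles at `a_δ`, `b_δ`) can be met
by a tree-admissible family: put the discrete marks at the corner (as in every figure of the
paper).  Reflex corners are deliberately excluded; convex-corner-marked rectilinear polygons are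
still Radó-dense among Dobrushin domains (what S5 needs). [cite: Zhou2024SLE6BondZ2, §1.3 Condition C] -/
def IsCornerMark (D : DobrushinDomain) (i : Fin 2) : Prop :=
  ∃ (r : ℝ) (η : ℂ), 0 < r ∧ (η = 1 ∨ η = Complex.I ∨ η = -1 ∨ η = -Complex.I) ∧
    D.carrier ∩ Metric.ball (D.pt i) r =
      {z | z ∈ Metric.ball (D.pt i) r ∧ 0 < ((z - D.pt i) * (starRingEnd ℂ) η).re ∧
        0 < ((z - D.pt i) * (starRingEnd ℂ) η).im}

/-- **SLE₆ on the Zhou class, ∃-family form**: every corner-marked rectilinear Dobrushin polygon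
admits SOME admissible square-lattice discretisation family (`ZdDiscretisationFamily`: canonical
vertex set `meshDomain D δ`, arcs → `(ab)`, `(ba)`, discrete marks → `{a, b}`, admissible eventually)
along which the bond-`ℤ²` interface converges in law to chordal SLE₆ — Zhou's Theorem 2 read on the
tree's vocabulary (the family with discrete marks AT the corners satisfies Condition C; the H21
boundary rendering `bcBondConfig` differs from the standard convention by one lattice step along
the dual-wired arc).  A STATEMENT of the line (conclusion of the registered stub `stub_zhouBackEnd`,
hypothesis of `stub_allDomainsOfZhouClass`), not a fact: it is what Zhou arXiv:2409.03235 v6, Theorem 2,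
claims (unrefereed). -/
def SLESixOnZhouClass : Prop :=
  ∀ D : DobrushinDomain, IsRectilinear D → IsCornerMark D 0 → IsCornerMark D 1 →
    ∃ E : ℝ → DiscreteDobrushin, ZdDiscretisationFamily D E ∧
      ConvergesInLawToSLE 6 D (Ωδ := fun _ => BondConfig (Site 2))
        (fun δ => Literature.Probability.Percolation.bondInterfaceIn D (E δ))
        (fun _ => bondPercolation (zdGraph 2) half)

/-- `HalfCR c` unfolded to tree vocabulary: VERBATIM the registered signature of `stub_halfCR` after
`∃ c ∈ {i, −i}` (registered glue sub-goal `halfCR_iff` of stmt-CriticalPhenomena-17239, used by the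
skeleton's `halfCR_of_stub`). [cite: DuminilCopin2012Parafermion, Proposition 4] -/
theorem halfCR_iff : ∀ c : ℂ, HalfCR c ↔
    ∀ E : DiscreteDobrushin, E.IsZdAdmissible → HoleFree {f : Site 2 | E.IsInnerFace f} → 0 < E.δ →
      (meshDomain E.Ω E.δ).Finite → ∀ p ∈ halfCREquations E,
        HalfCRRelationAt c (fun e : Site 2 × Site 2 => bondDartObservable E E.δ (1 / 3) e) p :=
  fun _ => Iff.rfl

end Summit.CriticalPhenomena.CardyFormulaZ2.Theorems.SymmetryUpgradeR.ZhouRotationSplitAudit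

end
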